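import Literature.NumberTheory.EllipticCurves.RealLatticeRealLocusProofs
import Literature.NumberTheory.EllipticCurves.ModularCurveRealPeriodProofs
import Literature.NumberTheory.EllipticCurves.ModularCurvePeriodRatio
import HarnessLib

/-!
# Crux C1 `MainConjectureTransportAlignedAtTwo` (stmt-BirchSwinnertonDyer-22296), line `birth`, plan «deltapos-galois» step (K2):
# THE MOD-2 PLUS FUNCTIONAL IS THE WEIL PAIRING WITH `T*` — for `Δ(W) > 0`, an odd Manin constant and the `2`-adic period unit, the integer plus value
# `n(x) = (2/Ω⁺_f)·re x(f)` of a cycle `x ∈ H₁(X₀(N);ℤ)` is EVEN iff the `2`-torsion point `u_W(c·x(f)/2)` is `O` or `T* = u_W(iΩ₀'/2)` (lead att-p1 g10; `--supports 22296`)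

THEOREMS ONLY (no `def`, no `sorry`, no named fact). BSD is not proved by this; C1 is not closed by this.

Context (`Cruxes/MainConjectureTransportAlignedAtTwo/Lines/birth-deltapos-galois-plan.md`, file (K2); memo `DELTA-POS-REAL-LOCUS-att-p1-g10.md` §3, REF2 v40-add3 (A4)).
For a parametrisation datum `D : ModularParametrizationData W N` (Néron lattice `Λ_E = D.L.lattice`, uniformisation `u_W = D.uniformize`, Manin constant `c = D.c`
with `cΛ_f ⊆ Λ_E`) of a curve with `Δ(W) > 0`, the lattice is real and RECTANGULAR: `Λ_E = ℤΩ₀ ⊕ ℤ·iΩ₀'` (`Ω₀`, `Ω₀'` the least positive real periods of `Λ_E` and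
`iΛ_E`; §1, from the tree's `IsReal.exists_re_eq_int_mul_of_discr_pos` and `IsReal.exists_eq_int_mul`). The plus period functional of the line is
`n(x) = (2/Ω⁺_f)·re x(f) ∈ ℤ`; with the real period `Ω(W) = 2Ω₀` (`realPeriodRat_eq_numRealComponents_mul`) and the PRINT period unit
`Ω(W) = u·Ω⁺_f`, `‖u‖₂ = 1` (`realPeriodRat_eq_unit_mul_plusPeriod_two`, taken here as the hypothesis `hΩ`), the `Ω₀`-coordinate `a` of `c·x(f) ∈ Λ_E` satisfies
`a·u = c·n`, so for ODD `c` (§2, `even_iff_even_of_mul_unit_eq_odd_mul`, `2`-adic norms) `a ≡ n (mod 2)`; and `a` is even iff `c·x(f)/2 ∈ Λ_E ∪ (w + Λ_E)`,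
`w = iΩ₀'/2` (§1). Main statements (§3): **`even_plusValue_iff_half_mem_or_sub_halfPeriodI_mem`** and its point form
**`even_plusValue_iff_uniformize_half`**: `Even n ↔ u_W(c·x(f)/2) = O ∨ u_W(c·x(f)/2) = u_W(w)`. By `…AlignedTransportAtTwoHalfPeriodOrdering` (p663962)
`u_W(w)` is the `2`-torsion point of least abscissa, i.e. the point `T*` of `AlignedAtInfinity`; in `jacobiMap` language (`jacobiMap_mk`) the statement reads
«`n̄(x) = 0 ↔ D.jacobiMap [x/2] ∈ {O, T*}`», i.e. `n̄ = e₂(T*, ·) ∘ jacobiMap` on `J₀(N)[2]` — the dictionary the Galois step (G1) consumes.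
The hypothesis `Odd D.c` is essential (an even `c` makes `jacobiMap D` vanish on `J₀(N)[2]`); see the plan's input T4 (Abbes–Ullmo for the optimal datum).

References: Cremona 1997 §2.8 (p. 26), §2.10 [CremonaAlgorithms1997]; Lange–Birkenhake §2.7.1 / §4.5 (Weil pairing on `½Λ/Λ`; `e₂(S,T) = −1 ⟺ S ≠ T ≠ O`);
Abbes–Ullmo 1996 Thm A [AbbesUllmo1996]; Greenberg–Vatsal 2000 §3 Rem. 3.4 [GreenbergVatsal2000].
-/

noncomputable section

-- justification: the `Summit.BirchSwinnertonDyer.BirchSwinnertonDyer.…` path repeats a component (route-file convention)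
set_option linter.dupNamespace false
set_option autoImplicit false

open scoped ComplexConjugate ModularForm
open Complex Set PeriodPair CongruenceSubgroup
open Literature.NumberTheory.EllipticCurves Literature.NumberTheory.EllipticCurves.ModularForms

namespace Summit.BirchSwinnertonDyer.BirchSwinnertonDyer.Theorems.AlignedTransportAtTwoDeltaPosFunctional

/-! ## §1 Rectangular real lattices: `Λ = ℤΩ₀ ⊕ ℤ·iΩ₀'`, and the parity of the `Ω₀`-coordinate -/

section Lattice

variable {L : PeriodPair}

/-- **Rectangular decomposition.** For a real lattice with `g₂³ − 27g₃² > 0`, every `z ∈ Λ` is `a·Ω₀ + k·(iΩ₀')` with `a, k ∈ ℤ` (`Ω₀`, `Ω₀'` the least positive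
real periods of `Λ` and `iΛ`). [cite: Lawden1989, §6.11–§6.12] [cite: CremonaAlgorithms1997, §2.8 (p. 26)] -/
theorem exists_eq_int_mul_add_int_mul_of_discr_pos (h : L.IsReal) (hdisc : 0 < L.g₂.re ^ 3 - 27 * L.g₃.re ^ 2) {z : ℂ} (hz : z ∈ L.lattice) :
    ∃ a k : ℤ, z = (a : ℂ) * (L.minRealPeriod : ℂ) + (k : ℂ) * (I * ((L.mulLeft I I_ne_zero).minRealPeriod : ℂ)) := by
  obtain ⟨a, ha⟩ := h.exists_re_eq_int_mul_of_discr_pos hdisc hz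
  have hΩmem : (a : ℂ) * (L.minRealPeriod : ℂ) ∈ L.lattice := by
    have := L.lattice.smul_mem a h.minRealPeriod_mem_lattice
    rwa [zsmul_eq_mul] at this
  set y : ℂ := z - (a : ℂ) * (L.minRealPeriod : ℂ) with hy
  have hymem : y ∈ L.lattice := sub_mem hz hΩmem
  have hyre : y.re = 0 := by
    rw [hy, Complex.sub_re, ha]
    simp
  -- `y = i·(y.im)` and `y.im` is a real period of `iΛ`
  have hyeq : y = I * ((y.im : ℝ) : ℂ) := by
    apply Complex.ext <;> simp [hyre]
  have hy' : ((y.im : ℝ) : ℂ) ∈ (L.mulLeft I I_ne_zero).lattice := by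
    rw [mem_mulLeft_lattice, Complex.inv_I]
    have := neg_mem hymem
    rw [hyeq] at this
    convert this using 1
    ring
  obtain ⟨k, hk⟩ := h.mulLeft_I.exists_eq_int_mul hy'
  refine ⟨a, k, ?_⟩
  have : z = (a : ℂ) * (L.minRealPeriod : ℂ) + y := by rw [hy]; ring
  rw [this, hyeq, hk]
  push_cast
  ring

/-- **Parity of the `Ω₀`-coordinate ↔ the half lies in `Λ ∪ (w + Λ)`**, `w = iΩ₀'/2`: for `z = aΩ₀ + k·iΩ₀' ∈ Λ` (rectangular real lattice),
`(z/2 ∈ Λ ∨ z/2 − w ∈ Λ) ↔ Even a`. [cite: CremonaAlgorithms1997, §2.8] -/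
theorem half_mem_or_sub_halfPeriodI_mem_iff_even (h : L.IsReal) (hdisc : 0 < L.g₂.re ^ 3 - 27 * L.g₃.re ^ 2) {a k : ℤ} :
    (((a : ℂ) * (L.minRealPeriod : ℂ) + (k : ℂ) * (I * ((L.mulLeft I I_ne_zero).minRealPeriod : ℂ))) / 2 ∈ L.lattice ∨
      ((a : ℂ) * (L.minRealPeriod : ℂ) + (k : ℂ) * (I * ((L.mulLeft I I_ne_zero).minRealPeriod : ℂ))) / 2 -
        I * ((((L.mulLeft I I_ne_zero).minRealPeriod / 2 : ℝ)) : ℂ) ∈ L.lattice) ↔ Even a := by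
  set Ω₀ : ℝ := L.minRealPeriod with hΩ₀
  set Ω₁ : ℝ := (L.mulLeft I I_ne_zero).minRealPeriod with hΩ₁
  have hΩpos : 0 < Ω₀ := h.minRealPeriod_pos
  obtain ⟨h2w, -, -⟩ := h.two_mul_halfPeriodI_mem
  have hΩmem : ∀ j : ℤ, (j : ℂ) * (Ω₀ : ℂ) ∈ L.lattice := fun j ↦ by
    have := L.lattice.smul_mem j h.minRealPeriod_mem_lattice
    rwa [zsmul_eq_mul] at this
  have hwmem : ∀ j : ℤ, (j : ℂ) * (2 * (I * (((Ω₁ / 2 : ℝ)) : ℂ))) ∈ L.lattice := fun j ↦ by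
    have := L.lattice.smul_mem j h2w
    rwa [zsmul_eq_mul] at this
  -- real parts of lattice elements are integer multiples of `Ω₀`
  have hre : ∀ y ∈ L.lattice, ∃ j : ℤ, y.re = j * Ω₀ := fun y hy ↦ h.exists_re_eq_int_mul_of_discr_pos hdisc hy
  constructor
  · -- `⇒`: the real part of `z/2` (or `z/2 − w`) is `(a/2)Ω₀`, an integer multiple of `Ω₀`
    rintro (hmem | hmem)
    · obtain ⟨j, hj⟩ := hre _ hmem
      have hre2 : (((a : ℂ) * (Ω₀ : ℂ) + (k : ℂ) * (I * (Ω₁ : ℂ))) / 2).re = a * Ω₀ / 2 := by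
        simp
      rw [hre2] at hj
      have hcancel : (a : ℝ) = 2 * j :=
        mul_right_cancel₀ hΩpos.ne' (by linarith : (a : ℝ) * Ω₀ = (2 * j) * Ω₀)
      exact ⟨j, by exact_mod_cast (by linarith : (a : ℝ) = j + j)⟩
    · obtain ⟨j, hj⟩ := hre _ hmem
      have hre2 : (((a : ℂ) * (Ω₀ : ℂ) + (k : ℂ) * (I * (Ω₁ : ℂ))) / 2 - I * (((Ω₁ / 2 : ℝ)) : ℂ)).re = a * Ω₀ / 2 := by
        simp
      rw [hre2] at hj
      have hcancel : (a : ℝ) = 2 * j :=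
        mul_right_cancel₀ hΩpos.ne' (by linarith : (a : ℝ) * Ω₀ = (2 * j) * Ω₀)
      exact ⟨j, by exact_mod_cast (by linarith : (a : ℝ) = j + j)⟩
  · -- `⇐`: `a = 2a'`; split on the parity of `k`
    rintro ⟨a', rfl⟩
    rcases Int.even_or_odd k with ⟨k', rfl⟩ | ⟨k', rfl⟩
    · left
      have : (((a' + a' : ℤ) : ℂ) * (Ω₀ : ℂ) + ((k' + k' : ℤ) : ℂ) * (I * (Ω₁ : ℂ))) / 2 =
          (a' : ℂ) * (Ω₀ : ℂ) + (k' : ℂ) * (2 * (I * (((Ω₁ / 2 : ℝ)) : ℂ))) := by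
        push_cast; ring
      rw [this]
      exact add_mem (hΩmem a') (hwmem k')
    · right
      have : (((a' + a' : ℤ) : ℂ) * (Ω₀ : ℂ) + ((2 * k' + 1 : ℤ) : ℂ) * (I * (Ω₁ : ℂ))) / 2 - I * (((Ω₁ / 2 : ℝ)) : ℂ) =
          (a' : ℂ) * (Ω₀ : ℂ) + (k' : ℂ) * (2 * (I * (((Ω₁ / 2 : ℝ)) : ℂ))) := by
        push_cast; ring
      rw [this]
      exact add_mem (hΩmem a') (hwmem k')

end Lattice

/-! ## §2 `2`-adic parity transfer along a unit -/

/-- If `a·u = c·n` in `ℚ` with `‖u‖₂ = 1` and `c` odd, then `a` is even iff `n` is even (`2`-adic norms). [folklore] -/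
theorem even_iff_even_of_mul_unit_eq_odd_mul {a c n : ℤ} {u : ℚ} (hu : ‖(u : ℚ_[2])‖ = 1) (hc : Odd c)
    (h : (a : ℚ) * u = c * n) : Even a ↔ Even n := by
  have hc1 : ‖(c : ℚ_[2])‖ = 1 := by
    refine le_antisymm (Padic.norm_int_le_one c) ?_
    by_contra hlt
    have h2 : (2 : ℤ) ∣ c := by
      have := (Padic.norm_intCast_lt_one_iff (p := 2)).mp (not_le.mp hlt)
      exact_mod_cast this
    exact (Int.not_even_iff_odd.mpr hc) (even_iff_two_dvd.mpr h2)
  have hnorm : ‖(a : ℚ_[2])‖ = ‖(n : ℚ_[2])‖ := by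
    have h' : (a : ℚ_[2]) * (u : ℚ_[2]) = (c : ℚ_[2]) * (n : ℚ_[2]) := by
      have := congrArg (fun q : ℚ ↦ (q : ℚ_[2])) h
      push_cast at this
      exact this
    have h'' := congrArg (‖·‖) h'
    simp only [norm_mul, hu, hc1, mul_one, one_mul] at h''
    exact h''
  have ha := Padic.norm_intCast_lt_one_iff (p := 2) (k := a)
  have hn := Padic.norm_intCast_lt_one_iff (p := 2) (k := n)
  push_cast at ha hn
  rw [even_iff_two_dvd, even_iff_two_dvd, ← ha, ← hn, hnorm]

/-! ## §3 The plus functional mod 2 is the pairing with `T*` -/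

section Curve

variable {W : WeierstrassCurve ℚ} [W.IsElliptic] {N : ℕ} [NeZero N] (D : ModularParametrizationData W N)

omit [W.IsElliptic] in
/-- `x(f) ∈ Λ_f` for `x ∈ H₁(X₀(N);ℤ)`, hence `c·x(f) ∈ Λ_E`. [folklore] -/
theorem maninConstant_mul_eval_mem {x : Module.Dual ℂ (CuspForm (Gamma0 N) 2)} (hx : x ∈ periodHomology N) :
    (D.c : ℂ) * x D.f ∈ D.L.lattice := by
  apply D.smul_periodLattice_le
  rw [periodLattice_eq_map_periodHomology]
  exact AddSubgroup.mem_map.mpr ⟨x, hx, rfl⟩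

omit [W.IsElliptic] in
/-- `disc(Λ_E) > 0` for `Δ(W) > 0`. [folklore] -/
theorem discr_pos_of_Δ_pos (hΔ : 0 < W.Δ) : 0 < D.L.g₂.re ^ 3 - 27 * D.L.g₃.re ^ 2 := by
  rw [D.discr_neronLattice]
  have : (W.baseChange ℝ).Δ = (W.Δ : ℝ) := by
    simp only [WeierstrassCurve.baseChange, WeierstrassCurve.map_Δ, eq_ratCast]
  rw [this]; exact_mod_cast hΔ

/-- `Ω(W) = 2Ω₀` for `Δ(W) > 0` (two real components). [cite: CremonaAlgorithms1997, §2.8 (p. 26)] -/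
theorem realPeriodRat_eq_two_mul_of_Δ_pos (hΔ : 0 < W.Δ) : W.realPeriodRat = 2 * D.L.minRealPeriod := by
  rw [D.realPeriodRat_eq_numRealComponents_mul]
  have hΔ' : 0 < (W.baseChange ℝ).Δ := by
    have : (W.baseChange ℝ).Δ = (W.Δ : ℝ) := by
      simp only [WeierstrassCurve.baseChange, WeierstrassCurve.map_Δ, eq_ratCast]
    rw [this]; exact_mod_cast hΔ
  rw [(W.baseChange ℝ).numRealComponents_of_Δ_pos hΔ']
  norm_num

/-- **(K2) The mod-2 plus functional is the pairing with `T*` (lattice form).** `D` a parametrisation datum of `W` with `Δ(W) > 0` and ODD Manin constant `c`;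
`Ω(W) = u·Ω⁺_f` with `‖u‖₂ = 1` (the period unit at `2`); `x ∈ H₁(X₀(N);ℤ)` with integer plus value `n`, `n·Ω⁺_f = 2·re x(f)`. Then `n` is even iff
`c·x(f)/2 ∈ Λ_E` or `c·x(f)/2 − w ∈ Λ_E`, `w = iΩ₀'/2` the imaginary half-period. [cite: CremonaAlgorithms1997, §2.8 (p. 26), §2.10]
[cite: AbbesUllmo1996, Thm. A] -/
theorem even_plusValue_iff_half_mem_or_sub_halfPeriodI_mem (hΔ : 0 < W.Δ) (hc : Odd D.c) {u : ℚ} (hu : ‖(u : ℚ_[2])‖ = 1)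
    (hΩ : W.realPeriodRat = u * plusPeriod D.f) {x : Module.Dual ℂ (CuspForm (Gamma0 N) 2)} (hx : x ∈ periodHomology N)
    {n : ℤ} (hn : (n : ℝ) * plusPeriod D.f = 2 * (x D.f).re) :
    Even n ↔ ((D.c : ℂ) * x D.f / 2 ∈ D.L.lattice ∨
      (D.c : ℂ) * x D.f / 2 - I * ((((D.L.mulLeft I I_ne_zero).minRealPeriod / 2 : ℝ)) : ℂ) ∈ D.L.lattice) := by
  have hreal := D.isReal_neronLattice
  have hdisc := discr_pos_of_Δ_pos D hΔ
  have hΩpos : 0 < D.L.minRealPeriod := hreal.minRealPeriod_pos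
  obtain ⟨a, k, hak⟩ := exists_eq_int_mul_add_int_mul_of_discr_pos hreal hdisc (maninConstant_mul_eval_mem D hx)
  rw [hak, half_mem_or_sub_halfPeriodI_mem_iff_even hreal hdisc]
  -- it remains: `Even n ↔ Even a`, from `a·u = c·n`
  have hre : ((D.c : ℂ) * x D.f).re = a * D.L.minRealPeriod := by
    rw [hak]; simp
  have hre' : ((D.c : ℂ) * x D.f).re = D.c * (x D.f).re := by
    simp [Complex.mul_re]
  have hu0 : u ≠ 0 := by
    rintro rfl; simp at hu
  have h2 : W.realPeriodRat = 2 * D.L.minRealPeriod := realPeriodRat_eq_two_mul_of_Δ_pos D hΔ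
  -- `a·Ω₀ = c·re x(f)`, `2·re x(f)·u = n·Ω⁺·u = 2nΩ₀`, hence `Ω₀·(a·u − c·n) = 0`
  have hplus' : plusPeriod D.f * u = 2 * D.L.minRealPeriod := by
    have hu0' : (u : ℝ) ≠ 0 := by exact_mod_cast hu0
    rw [← h2, hΩ]; field_simp
  have key : (a : ℝ) * u = D.c * n := by
    have h1 : (a : ℝ) * D.L.minRealPeriod = D.c * (x D.f).re := by rw [← hre, hre']
    have h3 : 2 * ((x D.f).re * u) = 2 * (n * D.L.minRealPeriod) := by
      calc 2 * ((x D.f).re * u) = (n * plusPeriod D.f) * u := by rw [hn]; ring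
        _ = n * (plusPeriod D.f * u) := by ring
        _ = 2 * (n * D.L.minRealPeriod) := by rw [hplus']; ring
    have h3' : (x D.f).re * u = n * D.L.minRealPeriod := by linarith
    have h4 : D.L.minRealPeriod * ((a : ℝ) * u - D.c * n) = 0 := by
      linear_combination (u : ℝ) * h1 + (D.c : ℝ) * h3'
    rcases mul_eq_zero.mp h4 with h0 | h0
    · exact absurd h0 hΩpos.ne'
    · linarith
  have key' : (a : ℚ) * u = D.c * n := by exact_mod_cast key
  exact (even_iff_even_of_mul_unit_eq_odd_mul hu hc key').symm

/-- **(K2) point form.** Same hypotheses; with `u_W = D.uniformize` (kernel `Λ_E`): `n` is even iff `u_W(c·x(f)/2) = O` or `u_W(c·x(f)/2) = u_W(w)` — and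
`u_W(w)` is the `2`-torsion point of least abscissa (`…AlignedTransportAtTwoHalfPeriodOrdering`, p663962), the point `T*` of `AlignedAtInfinity`; by
`jacobiMap_mk` the left point is `D.jacobiMap [x/2]`. [cite: CremonaAlgorithms1997, §2.8, §2.10] [cite: AbbesUllmo1996, Thm. A] -/
theorem even_plusValue_iff_uniformize_half (hΔ : 0 < W.Δ) (hc : Odd D.c) {u : ℚ} (hu : ‖(u : ℚ_[2])‖ = 1)
    (hΩ : W.realPeriodRat = u * plusPeriod D.f) {x : Module.Dual ℂ (CuspForm (Gamma0 N) 2)} (hx : x ∈ periodHomology N)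
    {n : ℤ} (hn : (n : ℝ) * plusPeriod D.f = 2 * (x D.f).re) :
    Even n ↔ (D.uniformize ((D.c : ℂ) * x D.f / 2) = 0 ∨
      D.uniformize ((D.c : ℂ) * x D.f / 2) = D.uniformize (I * ((((D.L.mulLeft I I_ne_zero).minRealPeriod / 2 : ℝ)) : ℂ))) := by
  rw [even_plusValue_iff_half_mem_or_sub_halfPeriodI_mem D hΔ hc hu hΩ hx hn]
  have hker : ∀ z : ℂ, D.uniformize z = 0 ↔ z ∈ D.L.lattice := fun z ↦ by
    rw [← SetLike.mem_coe, ← D.ker_uniformize, SetLike.mem_coe, AddMonoidHom.mem_ker]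
  rw [hker, ← sub_eq_zero (a := D.uniformize _), ← map_sub, hker]

end Curve

end Summit.BirchSwinnertonDyer.BirchSwinnertonDyer.Theorems.AlignedTransportAtTwoDeltaPosFunctional

end
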